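import Mathlib.Data.Nat.BinaryRec
import Mathlib.Data.Nat.Size
import Mathlib.Data.Nat.Bits
import Mathlib.Data.Fin.Tuple.Basic
import Mathlib.Data.Fin.VecNotation
import Mathlib.Computability.Encoding
import Literature.Computability.Complexity.Classes
import Literature.Computability.MetaComplexity.BoundedArithSyntax
import Literature.Computability.MetaComplexity.BoundedArithTheories
import HarnessLib

-- provenance: harness21/H21/H21/Prelude/AnalysisL/PVFunctions.lean @ 4102374 (interim HEAD d8f2665); M5 mechanical rewrite
/-!
# Cook's `PV` function symbols and Cobham's function algebra (trunk CplxMeta, G28 item P8)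

Cobham's machine-independent characterisation of polynomial time (Cobham 1965) is the least
class of number-theoretic functions containing a few initial functions and closed under
composition and *limited recursion on notation*.  Cook's equational theory `PV`
(Cook 1975, §2) has one function symbol for every description of such a function.  This file
provides the *syntax* of these descriptions as an inductive family `PVFun n` of `n`-ary
function symbols together with their (total) standard interpretation `PVFun.eval` on `ℕ`,
the induced notion `IsPVDefinable`, and the two classical characterisations

* `cobham` : a unary function is PV-definable iff it is polynomial-time computable on
  binary notation (Cobham 1965; Rose 1984, Ch. 3; Clote–Kranakis 2002, Thm. '?');
* `isPVDefinable_iff_isSigmabDefinable` : PV-definable = `Σᵇ₁`-definable in `S₂¹`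
  (Buss 1986, Ch. 5 Main Theorem, combined with `cobham`).

## Design choices

* The initial functions are `0`, projections, the two binary successors `s₀ x = 2x`,
  `s₁ x = 2x + 1` (`bit b`), `⌊x/2⌋` (`half`), `|x|` (`len`), `x # y = 2^(|x|·|y|)` (`smash`),
  `+`, `·` and the conditional `cond`.  Compared with Cobham 1965 (whose initial functions
  are `sᵢ`, smash-like `x^{|y|}` and constants) this list is redundant, but the closure under
  composition and limited recursion on notation is the same class; keeping all of Buss's
  non-logical symbols except `S` as constructors lets `Language.boundedArith` embed into the
  language of `PV` symbol-to-symbol (item P9).  Buss's successor `S` is the *derived* term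
  `PVFun.succ = x + s₁(0)`.
* Limited recursion on notation `limRec g h k` carries its bounding function `k` as data and
  the semantics truncates by `min … (k …)` at every stage ('?' presentation, following the
  "bounded/limited recursion" of Rose 1984, Ch. 3 and Clote–Kranakis 2002): whenever
  Cobham's side condition `f(x, y) ≤ k(x, y)` holds the truncation is the identity, and in
  general the truncated function is again in Cobham's class, so the class of functions
  `IsPVDefinable` is exactly Cobham's `𝓛` = `FP`.
* `eval` is total and structurally recursive; the recursion argument of `limRec` is the
  *last* argument (`Fin.init` / `Fin.snoc`), matching Buss's and Cook's `f(x⃗, y)`.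
* Mathlib has no Cobham algebra / `PV` (searched `Cobham`, `recursion on notation`,
  `PolyTime` in `Mathlib.Computability`); Mathlib's `Nat.Primrec` is the analogous but
  different (primitive recursive) syntax-free class.  Anchors used: `Nat.bit`,
  `Nat.binaryRec`, `Nat.size`, `Fin.snoc`, `Fin.init`, `Computability.encodeNat`,
  and the accepted H21 `CplxCore.PolyTimeComputable`, `CplxMeta.IsSigmabDefinable`,
  `CplxMeta.S2`.
* This Prelude file does not import `Literature.Statements.PNP.BoundedArithmetic` (where Buss's
  witnessing theorem `PNP.buss_witnessing` is stated); the corollary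
  `isPVDefinable_iff_isSigmabDefinable` is therefore a sorried theorem citing it.

## References

* A. Cobham, *The intrinsic computational difficulty of functions*, Proc. 1964 Congress
  Logic, Methodology and Philosophy of Science, North-Holland 1965, 24–30.
* S. A. Cook, *Feasibly constructive proofs and the propositional calculus*, STOC 1975, §2.
* H. E. Rose, *Subrecursion: functions and hierarchies*, OUP 1984, Ch. 3.
* P. Clote, E. Kranakis, *Boolean Functions and Computation Models*, Springer 2002, Ch. '?'.
* S. R. Buss, *Bounded Arithmetic*, Bibliopolis 1986, Ch. 5–6.
-/

namespace Literature.Analysis.FunctionSpaces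

open _root_.Computability Literature.Computability.Complexity

/-- `PVFun n`: descriptions of `n`-ary functions in Cobham's function algebra, i.e. the
`n`-ary function symbols of Cook's theory `PV` (Cook 1975, §2; Cobham 1965).  Initial
symbols: `zero` (the constant `0`), `proj i` (projections), `bit b` (binary successors
`sᵢ x = 2x + i`), `half` (`⌊x/2⌋`), `len` (`|x|`), `smash` (`x # y = 2^(|x|·|y|)`), `add`,
`mul`, `cond` (`cond x y z = if x = 0 then y else z`); operations: composition `comp` and
limited recursion on notation `limRec g h k` with bound `k`.  Buss's symbols other than `S`
are initial so that `Language.boundedArith` embeds symbol-to-symbol; this is redundant with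
respect to Cobham 1965 but the closure is unchanged. [cite: Cook1975, §2] -/
inductive PVFun : ℕ → Type
  /-- The `0`-ary constant `0`. -/
  | zero : PVFun 0
  /-- The projection `(x₀, …, xₙ₋₁) ↦ xᵢ`. -/
  | proj {n : ℕ} (i : Fin n) : PVFun n
  /-- The binary successor `s_b : x ↦ 2x + b` (Cook 1975 `s₀, s₁`). -/
  | bit (b : Bool) : PVFun 1
  /-- `x ↦ ⌊x/2⌋` (Cook's `TR`, Buss's `⌊½x⌋`). -/
  | half : PVFun 1
  /-- Binary length `x ↦ |x|`. -/
  | len : PVFun 1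
  /-- Smash `x # y = 2^(|x|·|y|)` (Buss 1986). -/
  | smash : PVFun 2
  /-- Addition. -/
  | add : PVFun 2
  /-- Multiplication. -/
  | mul : PVFun 2
  /-- Conditional `cond x y z = if x = 0 then y else z`. -/
  | cond : PVFun 3
  /-- Composition `f(g₀(x⃗), …, gₘ₋₁(x⃗))`. -/
  | comp {n m : ℕ} (f : PVFun m) (g : Fin m → PVFun n) : PVFun n
  /-- Limited recursion on notation: `f(x⃗, 0) = g(x⃗)`,
  `f(x⃗, s_b y) = h_b(x⃗, y, f(x⃗, y))`, everything truncated by `k(x⃗, y)`. -/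
  | limRec {n : ℕ} (g : PVFun n) (h : Bool → PVFun (n + 2)) (k : PVFun (n + 1)) :
      PVFun (n + 1)

namespace PVFun

variable {n m : ℕ}

/-- Buss's successor `S x = x + 1` as the derived `PV` term `x + s₁(0)`; not a constructor of
`PVFun` (Buss 1986, §2.2; used by the symbol table of item P9). [cite: Buss1986, §2.2] -/
def succ : PVFun 1 :=
  comp add ![proj 0, comp (bit true) ![comp zero ![]]]

/-- The standard interpretation of a `PV` function symbol as a total function
`(Fin n → ℕ) → ℕ` (Cook 1975, §2; Cobham 1965).  The clause for `limRec g h k` recurses on the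
binary notation of the *last* argument via `Nat.binaryRec`, truncating both the base case and
every step by the bound `k` (`min`), which enforces Cobham's side condition
`f(x⃗, y) ≤ k(x⃗, y)`; under that side condition the truncation is the identity. [cite: Cook1975, §2] -/
def eval : {n : ℕ} → PVFun n → (Fin n → ℕ) → ℕ
  | _, zero, _ => 0
  | _, proj i, x => x i
  | _, bit b, x => Nat.bit b (x 0)
  | _, half, x => x 0 / 2
  | _, len, x => Nat.size (x 0)
  | _, smash, x => 2 ^ (Nat.size (x 0) * Nat.size (x 1))
  | _, add, x => x 0 + x 1
  | _, mul, x => x 0 * x 1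
  | _, cond, x => if x 0 = 0 then x 1 else x 2
  | _, comp f g, x => f.eval (fun i => (g i).eval x)
  | _, limRec g h k, x =>
      Nat.binaryRec (motive := fun _ => ℕ)
        (min (g.eval (Fin.init x)) (k.eval (Fin.snoc (Fin.init x) 0)))
        (fun b y r => min ((h b).eval (Fin.snoc (Fin.snoc (Fin.init x) y) r))
          (k.eval (Fin.snoc (Fin.init x) (Nat.bit b y))))
        (x (Fin.last _))

/-- `0` evaluates to `0` (Cook 1975, §2). [cite: Cook1975, §2] -/
@[simp] theorem eval_zero (x : Fin 0 → ℕ) : zero.eval x = 0 := rfl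

/-- Projections evaluate to coordinates (Cobham 1965). [cite: Cobham1965] -/
@[simp] theorem eval_proj (i : Fin n) (x : Fin n → ℕ) : (proj i).eval x = x i := rfl

/-- `s_b x = 2x + b` (Cook 1975, §2). [cite: Cook1975, §2] -/
@[simp] theorem eval_bit (b : Bool) (x : Fin 1 → ℕ) : (bit b).eval x = Nat.bit b (x 0) := rfl

/-- `half x = ⌊x/2⌋` (Cook 1975 `TR`; Buss 1986, §2.2). [cite: Cook1975, TR] -/
@[simp] theorem eval_half (x : Fin 1 → ℕ) : half.eval x = x 0 / 2 := rfl

/-- `len x = |x|`, the binary length (Buss 1986, §2.2). [cite: Buss1986, §2.2] -/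
@[simp] theorem eval_len (x : Fin 1 → ℕ) : len.eval x = Nat.size (x 0) := rfl

/-- `x # y = 2^(|x|·|y|)` (Buss 1986, §2.2). [cite: Buss1986, §2.2] -/
@[simp] theorem eval_smash (x : Fin 2 → ℕ) :
    smash.eval x = 2 ^ (Nat.size (x 0) * Nat.size (x 1)) := rfl

/-- Addition (Buss 1986, §2.2). [cite: Buss1986, §2.2] -/
@[simp] theorem eval_add (x : Fin 2 → ℕ) : add.eval x = x 0 + x 1 := rfl

/-- Multiplication (Buss 1986, §2.2). [cite: Buss1986, §2.2] -/
@[simp] theorem eval_mul (x : Fin 2 → ℕ) : mul.eval x = x 0 * x 1 := rfl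

/-- The conditional `cond x y z = if x = 0 then y else z` (Cobham 1965; Buss 1986, Ch. 6). [cite: Cobham1965] -/
@[simp] theorem eval_cond (x : Fin 3 → ℕ) :
    cond.eval x = if x 0 = 0 then x 1 else x 2 := rfl

/-- Composition evaluates as composition (Cobham 1965). [cite: Cobham1965] -/
@[simp] theorem eval_comp (f : PVFun m) (g : Fin m → PVFun n) (x : Fin n → ℕ) :
    (comp f g).eval x = f.eval (fun i => (g i).eval x) := rfl

/-- The derived successor term evaluates to `x + 1` (Buss 1986, §2.2). [cite: Buss1986, §2.2] -/
@[simp] theorem eval_succ (x : Fin 1 → ℕ) : succ.eval x = x 0 + 1 := by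
  simp [succ]

/-- Unfolding of the `limRec` clause of `eval` as a `Nat.binaryRec` on the last argument
(Cook 1975, §2, limited recursion on notation). [cite: Cook1975, §2  limited recursion on notation] -/
theorem eval_limRec (g : PVFun n) (h : Bool → PVFun (n + 2)) (k : PVFun (n + 1))
    (x : Fin (n + 1) → ℕ) :
    (limRec g h k).eval x =
      Nat.binaryRec (motive := fun _ => ℕ)
        (min (g.eval (Fin.init x)) (k.eval (Fin.snoc (Fin.init x) 0)))
        (fun b y r => min ((h b).eval (Fin.snoc (Fin.snoc (Fin.init x) y) r))
          (k.eval (Fin.snoc (Fin.init x) (Nat.bit b y))))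
        (x (Fin.last n)) := rfl

/-- Base case of limited recursion on notation:
`f(x⃗, 0) = min (g x⃗) (k(x⃗, 0))` (Cook 1975, §2; Cobham 1965). [cite: Cook1975, §2] -/
@[simp] theorem eval_limRec_zero (g : PVFun n) (h : Bool → PVFun (n + 2)) (k : PVFun (n + 1))
    (x : Fin n → ℕ) :
    (limRec g h k).eval (Fin.snoc x 0) = min (g.eval x) (k.eval (Fin.snoc x 0)) := by
  simp [eval_limRec]

/-- Step of limited recursion on notation: for `s_b y ≠ 0`,
`f(x⃗, s_b y) = min (h_b(x⃗, y, f(x⃗, y))) (k(x⃗, s_b y))` (Cook 1975, §2; Cobham 1965).  The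
hypothesis excludes the degenerate notation `s₀ 0 = 0`. [cite: Cook1975, §2] -/
theorem eval_limRec_bit (g : PVFun n) (h : Bool → PVFun (n + 2)) (k : PVFun (n + 1))
    (x : Fin n → ℕ) (b : Bool) (y : ℕ) (hy : y = 0 → b = true) :
    (limRec g h k).eval (Fin.snoc x (Nat.bit b y)) =
      min ((h b).eval (Fin.snoc (Fin.snoc x y) ((limRec g h k).eval (Fin.snoc x y))))
        (k.eval (Fin.snoc x (Nat.bit b y))) := by
  simp only [eval_limRec, Fin.init_snoc, Fin.snoc_last]
  rw [Nat.binaryRec_eq _ _ (Or.inr hy)]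

/-- The (truncated) predecessor `x ↦ x - 1` as a `PV` term, by limited recursion on notation:
`P 0 = 0`, `P(s₁ y) = s₀ y`, `P(s₀ y) = s₁ (P y)` (for `y ≠ 0`), bounded by `y` itself
(Cook 1975, §2, among the first derived functions of `PV`). [cite: Cook1975, §2  among the first derived functions of] -/
def pred : PVFun 1 :=
  limRec zero
    (fun b => bif b then comp (bit false) ![proj 0] else comp (bit true) ![proj 1])
    (proj 0)

/-- `Fin.snoc` into `Fin 1` at `0` (definitional helper for `eval_pred`; Mathlib `Fin.snoc`). [folklore] -/
private theorem snoc_elim0_zero (y : ℕ) : Fin.snoc (α := fun _ => ℕ) Fin.elim0 y 0 = y := rfl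

/-- `Fin.snoc` into `Fin 2` at `1` (definitional helper for `eval_pred`; Mathlib `Fin.snoc`). [folklore] -/
private theorem snoc_one_one (v : Fin 1 → ℕ) (r : ℕ) :
    Fin.snoc (α := fun _ => ℕ) v r 1 = r := rfl

/-- `pred` evaluates to the predecessor (Cook 1975, §2). [cite: Cook1975, §2] -/
theorem eval_pred (x : Fin 1 → ℕ) : pred.eval x = x 0 - 1 := by
  suffices h : ∀ y : ℕ, pred.eval (Fin.snoc Fin.elim0 y) = y - 1 by
    have hx : x = Fin.snoc Fin.elim0 (x 0) := by
      funext i; fin_cases i; rfl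
    rw [hx]; exact h (x 0)
  intro y
  induction y using Nat.binaryRec' with
  | zero => simp [pred]
  | bit b y hy ih =>
    rw [pred, eval_limRec_bit _ _ _ _ _ _ hy, ← pred]
    cases b
    · have hy0 : y ≠ 0 := fun h => by simpa using hy h
      simp [ih, Nat.bit_val, snoc_elim0_zero, snoc_one_one]; omega
    · simp [Nat.bit_val, snoc_elim0_zero]

/-- The co-signum `s̄g x = if x = 0 then 1 else 0` as a `PV` term via `cond`
(Rose 1984, Ch. 3; Cook 1975, §2). [cite: Rose1984, Ch. 3] -/
def sg : PVFun 1 :=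
  comp cond ![proj 0, comp succ ![comp zero ![]], comp zero ![]]

/-- `sg` evaluates to the characteristic function of `{0}` (Rose 1984, Ch. 3). [cite: Rose1984, Ch. 3] -/
@[simp] theorem eval_sg (x : Fin 1 → ℕ) : sg.eval x = if x 0 = 0 then 1 else 0 := by
  simp [sg]

end PVFun

/-- A number-theoretic function `F : ℕⁿ → ℕ` is *`PV`-definable* (lies in Cobham's class `𝓛`)
if it is the interpretation of some `PV` function symbol (Cobham 1965; Cook 1975, §2). [cite: Cobham1965] -/
def IsPVDefinable {n : ℕ} (F : (Fin n → ℕ) → ℕ) : Prop :=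
  ∃ f : PVFun n, f.eval = F

/-- Every `PV` symbol defines a `PV`-definable function (tautological; Cook 1975, §2). [cite: Cook1975, §2] -/
theorem PVFun.isPVDefinable_eval {n : ℕ} (f : PVFun n) : IsPVDefinable f.eval := ⟨f, rfl⟩

/-- Cobham's class is closed under composition (Cobham 1965). [cite: Cobham1965] -/
theorem IsPVDefinable.comp {n m : ℕ} {F : (Fin m → ℕ) → ℕ} {G : Fin m → (Fin n → ℕ) → ℕ}
    (hF : IsPVDefinable F) (hG : ∀ i, IsPVDefinable (G i)) :
    IsPVDefinable (fun x => F (fun i => G i x)) := by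
  obtain ⟨f, rfl⟩ := hF
  choose g hg using hG
  exact ⟨PVFun.comp f g, by funext x; simp [hg]⟩

/-- **Cobham's theorem** (Cobham 1965; Rose 1984, Ch. 3, Thm. '?'; Clote–Kranakis 2002,
Thm. '?').  A unary function `F : ℕ → ℕ` lies in Cobham's class `𝓛` — is the interpretation
of a `PV` function symbol — if and only if it is computable in polynomial time on binary
notation, here `PolyTimeComputable encodeNat encodeNat F` over Mathlib's TM2 model with the
binary encoding `Computability.encodeNat` (the typing of the accepted `PNP.buss_witnessing`).
Stated for unary functions; the `n`-ary version reduces to it by polynomial-time tupling. [cite: Cobham1965] -/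
def cobham : Prop :=
  ∀ (F : ℕ → ℕ),
    IsPVDefinable (fun v : Fin 1 → ℕ => F (v 0)) ↔ PolyTimeComputable encodeNat encodeNat F

/-- `PV`-definability coincides with `Σᵇ₁`-definability in Buss's `S₂¹` for unary functions
(Buss 1986, Ch. 5 Main Theorem and Ch. 6; Cobham 1965).  Paper proof, two lines: by `cobham`
the left-hand side is `PolyTimeComputable encodeNat encodeNat F`, and by Buss's witnessing
theorem (`Literature.Computability.Complexity.buss_witnessing`, statement `pnp.S38` in
`H21/Statements/PNP/BoundedArithmetic.lean`) so is the right-hand side.  It is not derived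
here because a Prelude file must not import a Statements file. [cite: Buss1986, Ch. 5 Main Theorem and Ch. 6] -/
def isPVDefinable_iff_isSigmabDefinable : Prop :=
  ∀ (F : ℕ → ℕ),
    IsPVDefinable (fun v : Fin 1 → ℕ => F (v 0)) ↔ Literature.Computability.MetaComplexity.IsSigmabDefinable (Literature.Computability.MetaComplexity.S2 1) 1 F

end Literature.Analysis.FunctionSpaces
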